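import Summits.CriticalPhenomena.CardyFormulaZ2.Theses.CardyMagicRigidity
import Literature.Probability.RandomPlanarGeometry.JordanBoundaryWinding
import Literature.Probability.RandomPlanarGeometry.RadoConvergenceProofs
import Literature.Probability.RandomPlanarGeometry.ConformalRectangleProofs
import Literature.Probability.RandomPlanarGeometry.ConformalMapRiemannNormalisedProofs
import Literature.Probability.RandomPlanarGeometry.CardyFunctionIncBeta
import Literature.Probability.RandomPlanarGeometry.ConformalTube

/-!
# Candidate proof of stub D1 `stub_cardyContinuity` of line `oracle-sandwich`
(crux `LoopsToCrossings`, stmt-CriticalPhenomena-4837) — refuter evidence (positive; for the lead to land).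

`DrefuteD1.stub_cardyContinuity_proof` has exactly the stub's statement; `lean check` rc 0, 0 sorry,
axioms `{propext, Classical.choice, Quot.sound}`.  Structure:
* §P1 swallowing of deep points: `wind (∂Q - z) = wind (∂R - z) ≠ 0` when the loops are uniformly
  closer than `dist(z, ∂R)` (Rouché `wind_eq_of_norm_sub_lt`, `JordanDomain.wind_boundary_sub_ne_zero`),
  and `wind = 0` off `closure Q` (Eilenberg `hasLogOn_div_sub_of_mem_connectedComponentIn` with a far
  point of the outside `JordanDomain.exists_outside`);
* §P2 normalised Carathéodory charts (`exists_conformalEquiv_ball_deriv_pos`,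
  `JordanDomain.exists_continuousOn_extension_holds`, as `DiscChart`s);
* §P4 preimages converge under uniformly convergent charts with injective continuous limit;
* §P5 a uniformizing datum read off a chart with EXPLICIT `x i = Re cayley⁻¹((β t₁)⁻¹ · β(mark i))`
  (the construction of `MarkedDomain.exists_isUniformizing_of_disc`, parametric in the chart);
* §P6 core: Radó (`JordanDomain.rado_tendstoUniformlyOn_holds.closedBall`) ⇒ the explicit data of
  `Q_n` converge to those of `R`, hence (datum independence `crossRatio_eq_of_isUniformizing_holds`)
  eventually EVERY datum of `Q_n` has cross-ratio within `ε` of `R`'s;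
* §P7 the stub by contradiction, with `continuousOn_cardyFunction_holds`.
-/

noncomputable section

namespace Summit.CriticalPhenomena.CardyFormulaZ2.Cruxes.LoopsToCrossings.DrefuteD1

open Literature.Probability.RandomPlanarGeometry Set Filter Topology Metric Complex
open Literature.Topology.PlaneTopology Literature.Topology.PlaneTopology.JordanCurveProof
open UpperHalfPlane (upperHalfPlaneSet)

/-! ## §P1 Points deep inside `R` are inside every uniformly close Jordan curve -/

/-- **Outside a Jordan curve the boundary loop has winding number `0`.** For `z` off
`closure D`, `wind (∂D - z) = 0`: `z` lies in the unbounded complementary component `V`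
(`JordanDomain.exists_outside`), which contains points `b` of arbitrarily large modulus;
`w ↦ (w - z)/(w - b)` has a logarithm on `∂D` (Eilenberg), and so does `w ↦ w - b`
(principal branch), hence `w ↦ w - z` does. [cite: Mccleary2006, Ch. 9] -/
theorem wind_boundary_sub_eq_zero_of_not_mem (D : JordanDomain) {z : ℂ}
    (hz : z ∉ D.carrier) (hzf : z ∉ frontier D.carrier) :
    wind (fun t => D.boundary t - z) = 0 := by
  obtain ⟨e, he⟩ := D.exists_homeomorph_param_eq
  obtain ⟨V, hVo, hVc, hDV, hunion, -, hVb⟩ := D.exists_outside JordanCurveTheorem_holds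
  have hK : IsCompact (frontier D.carrier) := D.isCompact_frontier
  have hzV : z ∈ V := by
    have : z ∈ D.carrier ∪ V := by rw [hunion]; exact hzf
    exact this.resolve_left hz
  have hVK : V ⊆ (frontier D.carrier)ᶜ := by rw [← hunion]; exact subset_union_right
  obtain ⟨R₀, hR₀, hKR⟩ := hK.isBounded.subset_ball_lt 0 (0 : ℂ)
  -- a far point of `V`
  obtain ⟨b, hbV, hbfar⟩ : ∃ b ∈ V, 2 * R₀ < ‖b‖ := by
    by_contra hcon
    push Not at hcon
    exact hVb ((Metric.isBounded_closedBall (x := (0 : ℂ)) (r := 2 * R₀)).subset fun w hw =>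
      mem_closedBall_zero_iff.2 (hcon w hw))
  have hb0 : b ≠ 0 := by
    intro h; rw [h, norm_zero] at hbfar; linarith
  have hbK : ∀ w ∈ frontier D.carrier, w - b ≠ 0 := by
    intro w hw h
    have h1 := mem_ball_zero_iff.1 (hKR hw)
    rw [sub_eq_zero] at h
    rw [h] at h1
    linarith
  -- `b` lies in the component of `z`
  have hbcomp : b ∈ connectedComponentIn (frontier D.carrier)ᶜ z :=
    (hVc.isPreconnected.subset_connectedComponentIn hzV hVK) hbV
  have hlog1 : HasLogOn (fun w => (w - z) / (w - b)) (frontier D.carrier) :=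
    hasLogOn_div_sub_of_mem_connectedComponentIn hK.isClosed hbcomp
  -- `w ↦ w - b` has a logarithm on `K` (principal branch of `1 - w/b`, times the constant `-b`)
  have hlog2 : HasLogOn (fun w => w - b) (frontier D.carrier) := by
    have h1 : HasLogOn (fun w => (w - b) / (-b)) (frontier D.carrier) := by
      refine hasLogOn_of_norm_sub_one_lt (by fun_prop) fun w hw => ?_
      have hw := mem_ball_zero_iff.1 (hKR hw)
      have : (w - b) / (-b) - 1 = - (w / b) := by field_simp; ring
      rw [this, norm_neg, norm_div, div_lt_one (norm_pos_iff.2 hb0)]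
      linarith
    have h2 : HasLogOn (fun _ : ℂ => -b) (frontier D.carrier) :=
      hasLogOn_const (neg_ne_zero.2 hb0) _
    refine (h1.mul h2).congr fun w _ => ?_
    show (w - b) / (-b) * (-b) = w - b
    field_simp
  have hlog : HasLogOn (fun w => w - z) (frontier D.carrier) := by
    refine (hlog1.mul hlog2).congr fun w hw => ?_
    show (w - z) / (w - b) * (w - b) = w - z
    rw [div_mul_cancel₀ _ (hbK w hw)]
  have key := (hasLogOn_iff_wind_eq_zero e (F := fun w => w - z) (by fun_prop)
    (fun w hw h0 => hzf (sub_eq_zero.1 h0 ▸ hw))).1 hlog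
  have : ((fun w : ℂ => w - z) ∘ param e) = fun t => D.boundary t - z := by
    funext t; simp [Function.comp, he t]
  rw [this] at key
  exact key

/-- **Swallowing of deep points.** If the boundary loop of `Q` is uniformly closer to that of `R`
than the distance from `z ∈ R` to `∂R`, then `z ∈ Q`: by Rouché the two loops have the same
winding number about `z`, which is non-zero for `R` (`wind_boundary_sub_ne_zero`), while it would
vanish if `z` were outside `Q`. [cite: PommerenkeBBCM1992, Thm. 2.11] -/
theorem mem_carrier_of_forall_dist_boundary_lt (R Q : JordanDomain) {z : ℂ} (hz : z ∈ R.carrier)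
    (h : ∀ t, dist (Q.boundary t) (R.boundary t) < infDist z (frontier R.carrier)) :
    z ∈ Q.carrier := by
  have hwR : wind (fun t => R.boundary t - z) ≠ 0 := R.wind_boundary_sub_ne_zero hz
  have hzf : z ∉ frontier R.carrier := fun h' => Set.disjoint_left.1 R.disjoint_carrier_frontier hz h'
  have hR0 : ∀ t, R.boundary t - z ≠ 0 := fun t h0 =>
    hzf (sub_eq_zero.1 h0 ▸ R.boundary_mem_frontier t)
  have hwQ : wind (fun t => Q.boundary t - z) = wind (fun t => R.boundary t - z) := by
    refine wind_eq_of_norm_sub_lt (f := fun t => Q.boundary t - z) (g := fun t => R.boundary t - z)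
      ((Q.continuous_boundary.continuousOn).sub continuousOn_const) ?_ ⟨?_, fun t _ => hR0 t, ?_⟩ ?_
    · show Q.boundary 0 - z = Q.boundary 1 - z
      have := Q.periodic_boundary 0
      rw [zero_add] at this
      rw [this]
    · exact (R.continuous_boundary.continuousOn).sub continuousOn_const
    · show R.boundary 0 - z = R.boundary 1 - z
      have := R.periodic_boundary 0
      rw [zero_add] at this
      rw [this]
    · intro t _
      calc ‖(Q.boundary t - z) - (R.boundary t - z)‖ = dist (Q.boundary t) (R.boundary t) := by
            rw [dist_eq_norm]; congr 1; ring
        _ < infDist z (frontier R.carrier) := h t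
        _ ≤ dist z (R.boundary t) := infDist_le_dist_of_mem (R.boundary_mem_frontier t)
        _ = ‖R.boundary t - z‖ := by rw [dist_comm, dist_eq_norm]
  have hzfQ : z ∉ frontier Q.carrier := by
    intro hzQ
    rw [← Q.range_boundary] at hzQ
    obtain ⟨t, ht⟩ := hzQ
    have h1 := h t
    rw [ht] at h1
    exact absurd h1 (not_lt.2 (infDist_le_dist_of_mem (R.boundary_mem_frontier t)))
  by_contra hzQ
  have h0 := wind_boundary_sub_eq_zero_of_not_mem Q hzQ hzfQ
  rw [h0] at hwQ
  exact hwR hwQ.symm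

/-! ## §P2 Normalised Carathéodory charts -/

/-- A Carathéodory chart based at `z ∈ D` whose Riemann map is normalised by `f(0) = z`,
`f'(0) > 0` (real): the normalisation of Radó's theorem. [cite: PommerenkeBBCM1992, Thm. 2.6] -/
theorem exists_discChart_deriv_pos (D : JordanDomain) {z : ℂ} (hz : z ∈ D.carrier) :
    ∃ C : D.DiscChart, C.Φ 0 = z ∧ C.φ 0 = z ∧ 0 < (deriv C.φ 0).re ∧ (deriv C.φ 0).im = 0 := by
  obtain ⟨g, hg0, hre, him⟩ := exists_conformalEquiv_ball_deriv_pos D.isOpen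
    D.isSimplyConnected_holds D.carrier_ne_univ hz
  obtain ⟨Φ, hcont, heq, hbij, hsph⟩ := JordanDomain.exists_continuousOn_extension_holds D g.symm
  have hf0 : g.symm 0 = z := by
    have := g.symm_apply_apply hz
    rwa [hg0] at this
  have hd : deriv g.symm 0 * deriv g z = 1 := by
    have := g.deriv_symm_mul_deriv D.isOpen hz
    rwa [hg0] at this
  have hdf : 0 < (deriv g.symm 0).re ∧ (deriv g.symm 0).im = 0 := by
    set a := deriv g z with ha_def
    set b := deriv g.symm 0 with hb_def
    have ha : a = (a.re : ℂ) := Complex.ext (by simp) (by simp [him])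
    have hb : b = a⁻¹ := eq_inv_of_mul_eq_one_left hd
    rw [hb, ha, ← Complex.ofReal_inv]
    exact ⟨by rw [Complex.ofReal_re]; exact inv_pos.2 hre, Complex.ofReal_im _⟩
  refine ⟨⟨g.symm, Φ, hcont, heq, hbij, hsph⟩, ?_, hf0, hdf.1, hdf.2⟩
  show Φ 0 = z
  rw [heq (mem_ball_self one_pos)]
  exact hf0

/-! ## §P4 Preimages under uniformly convergent injective charts converge -/

/-- If `Φₙ → Φ` uniformly on a compact `K`, `Φ` is continuous and injective on `K`, `sₙ ∈ K`,
`a ∈ K` and `Φₙ(sₙ) → Φ(a)`, then `sₙ → a` (every cluster point `x` of `(sₙ)` has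
`Φ x = Φ a`). [folklore] -/
theorem tendsto_of_tendstoUniformlyOn_of_injOn {Φs : ℕ → ℂ → ℂ} {Φ : ℂ → ℂ} {K : Set ℂ}
    (hK : IsCompact K) (hunif : TendstoUniformlyOn Φs Φ atTop K) (hΦc : ContinuousOn Φ K)
    (hinj : InjOn Φ K) {s : ℕ → ℂ} (hs : ∀ n, s n ∈ K) {a : ℂ} (ha : a ∈ K)
    (hlim : Tendsto (fun n => Φs n (s n)) atTop (𝓝 (Φ a))) : Tendsto s atTop (𝓝 a) := by
  refine hK.tendsto_nhds_of_unique_mapClusterPt (Eventually.of_forall hs) fun x hx hcl => ?_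
  apply hinj hx ha
  have key : ∀ ε : ℝ, 0 < ε → dist (Φ x) (Φ a) < 3 * ε := by
    intro ε hε
    have h1 : ∀ᶠ n in atTop, ∀ w ∈ K, dist (Φ w) (Φs n w) < ε :=
      Metric.tendstoUniformlyOn_iff.1 hunif ε hε
    have h2 : ∀ᶠ n in atTop, dist (Φs n (s n)) (Φ a) < ε := Metric.tendsto_nhds.1 hlim ε hε
    obtain ⟨δ, hδ, h3⟩ := Metric.continuousWithinAt_iff.1 (hΦc x hx) ε hε
    have h4 : ∃ᶠ n in atTop, dist (s n) x < δ := by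
      have := (mapClusterPt_iff_frequently.1 hcl) (ball x δ) (ball_mem_nhds x hδ)
      exact this.mono fun n hn => mem_ball.1 hn
    obtain ⟨n, hn4, hn1, hn2⟩ := (h4.and_eventually (h1.and h2)).exists
    have hA : dist (Φ (s n)) (Φ x) < ε := h3 (hs n) hn4
    have hB : dist (Φ (s n)) (Φs n (s n)) < ε := hn1 (s n) (hs n)
    rw [dist_comm] at hA
    calc dist (Φ x) (Φ a) ≤ dist (Φ x) (Φ (s n)) + dist (Φ (s n)) (Φs n (s n)) +
          dist (Φs n (s n)) (Φ a) := dist_triangle4 _ _ _ _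
      _ < ε + ε + ε := add_lt_add (add_lt_add hA hB) hn2
      _ = 3 * ε := by ring
  refine eq_of_forall_dist_le fun ε hε => ?_
  have := key (ε / 3) (by positivity)
  linarith

/-! ## §P5 Uniformizing data read off a chart (Pommerenke, proof of Cor. 2.7) -/

/-- **Uniformizing datum from a Carathéodory chart, with explicit boundary preimages.** For a
conformal rectangle `D`, a chart `C` and a parameter `t₁` past the marks (`mark i < t₁ < 1`),
there is a uniformizing datum `(φ, x)` with
`x i = Re cayley⁻¹ ((C.β t₁)⁻¹ · C.β (mark i))` — the construction of
`MarkedDomain.exists_isUniformizing_of_disc`, made parametric in the chart.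
[cite: PommerenkeBBCM1992, Thm. 2.6 and Cor. 2.7] -/
theorem exists_isUniformizing_of_discChart (D : ConformalRectangle) (C : D.DiscChart)
    {t₁ : ℝ} (hmt : ∀ i, D.mark i < t₁) (ht1 : t₁ < 1) :
    ∃ (φ : ConformalEquiv upperHalfPlaneSet D.carrier) (x : Fin 4 → ℝ), D.IsUniformizing φ x ∧
      ∀ i, x i = (cayleyInvFun ((C.β t₁)⁻¹ * C.β (D.mark i))).re := by
  have h0 := (D.mark_mem 0).1
  have hmono := D.strictMono_mark
  set S : ℝ := (D.mark 3 + t₁) / 2 with hS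
  have hS3 : D.mark 3 < S := by rw [hS]; linarith [hmt 3]
  have hSt : S < t₁ := by rw [hS]; linarith [hmt 3]
  have hmS : ∀ i, D.mark i ≤ S := fun i =>
    (hmono.monotone (Fin.le_last i : i ≤ (3 : Fin 4))).trans hS3.le
  have hS0 : 0 ≤ S := h0.trans (hmS 0)
  have hS1 : S < 1 := hSt.trans ht1
  have ht0 : 0 ≤ t₁ := hS0.trans hSt.le
  set p₁ : ℂ := D.boundary t₁ with hp₁
  have hne : ∀ t ∈ Icc (0 : ℝ) S, D.boundary t ≠ p₁ := by
    intro t ht h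
    have hts : t = t₁ :=
      D.injOn_boundary ⟨ht.1, (ht.2.trans_lt hSt).trans ht1⟩ ⟨ht0, ht1⟩ h
    exact absurd (ht.2.trans_lt hSt) (by rw [hts]; exact lt_irrefl _)
  set η : ℂ := C.β t₁ with hη
  have hη1 : ‖η‖ = 1 := C.norm_β t₁
  have hη0 : η ≠ 0 := norm_ne_zero_iff.1 (by rw [hη1]; exact one_ne_zero)
  -- the rotated Riemann map `ψ₂ = C.φ ∘ (η ·)` and its extension `Ψ₂ = C.Φ ∘ (η ·)`
  set ψ₂ : ConformalEquiv (ball (0 : ℂ) 1) D.carrier := (rotBall η hη1).trans C.φ with hψ₂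
  set Ψ₂ : ℂ → ℂ := fun w ↦ C.Φ (η * w) with hΨ₂
  have hrot : MapsTo (fun w : ℂ ↦ η * w) (closedBall 0 1) (closedBall 0 1) := fun w hw ↦ by
    rw [mem_closedBall_zero_iff] at hw ⊢
    rwa [norm_mul, hη1, one_mul]
  have hΨ₂c : ContinuousOn Ψ₂ (closedBall 0 1) :=
    C.continuousOn.comp (continuous_const_mul η).continuousOn hrot
  have hΨ₂eq : EqOn Ψ₂ ψ₂ (ball 0 1) := fun w hw ↦ C.eqOn ((rotBall η hη1).mapsTo hw)
  -- the uniformizing map `φ = ψ₂ ∘ cayley : ℍₒ → D`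
  set φ : ConformalEquiv upperHalfPlaneSet D.carrier := cayley.trans ψ₂ with hφ
  have hΨ₂eq' : EqOn Ψ₂ (cayley.symm.trans φ) (ball 0 1) := fun w hw ↦ by
    rw [hΨ₂eq hw]
    change ψ₂ w = ψ₂ (cayley (cayley.symm w))
    rw [cayley.apply_symm_apply hw]
  -- the rotated circle preimage `w t` of `D.boundary t` and its real Cayley preimage `g t`
  set w : ℝ → ℂ := fun t ↦ η⁻¹ * C.β t with hw
  set g : ℝ → ℝ := fun t ↦ (cayleyInvFun (w t)).re with hg
  have hw1 : ∀ t, ‖w t‖ = 1 := fun t ↦ by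
    rw [hw]
    simp only [norm_mul, norm_inv, hη1, C.norm_β, inv_one, one_mul]
  have hwne : ∀ t, D.boundary t ≠ p₁ → w t ≠ 1 := by
    intro t ht h1
    apply ht
    have h2 : C.β t = η := by
      have : η * w t = η := by rw [h1, mul_one]
      rwa [hw, ← mul_assoc, mul_inv_cancel₀ hη0, one_mul] at this
    rw [← C.apply_β t, h2, hη, C.apply_β]
  have hcg : ∀ t, D.boundary t ≠ p₁ → cayleyFun (g t) = w t := fun t ht ↦ by
    rw [hg, ← cayleyInvFun_eq_ofReal_re (hw1 t), cayleyFun_cayleyInvFun (hwne t ht)]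
  have hΨ₂g : ∀ t, D.boundary t ≠ p₁ → Ψ₂ (cayleyFun (g t)) = D.boundary t := fun t ht ↦ by
    rw [hcg t ht, hΨ₂]
    change C.Φ (η * (η⁻¹ * C.β t)) = D.boundary t
    rw [← mul_assoc, mul_inv_cancel₀ hη0, one_mul, C.apply_β]
  -- `g` is continuous and injective, hence strictly monotone or antitone, on `[0, S]`
  have hgc : ContinuousOn g (Icc 0 S) := by
    have h2 : Continuous w := continuous_const.mul C.continuous_β
    have h3 : ContinuousOn (fun t ↦ cayleyInvFun (w t)) (Icc 0 S) :=
      differentiableOn_cayleyInvFun.continuousOn.comp h2.continuousOn fun t ht ↦ hwne t (hne t ht)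
    exact continuous_re.comp_continuousOn h3
  have hgi : InjOn g (Icc 0 S) := by
    intro s hs t ht hst
    have h1 : w s = w t := by rw [← hcg s (hne s hs), ← hcg t (hne t ht), hst]
    have h2 : C.β s = C.β t := mul_left_cancel₀ (inv_ne_zero hη0) h1
    have h3 : D.boundary s = D.boundary t := by rw [← C.apply_β s, h2, C.apply_β]
    exact D.injOn_boundary ⟨hs.1, hs.2.trans_lt hS1⟩ ⟨ht.1, ht.2.trans_lt hS1⟩ h3
  have hgm : StrictMonoOn g (Icc 0 S) ∨ StrictAntiOn g (Icc 0 S) :=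
    hgc.strictMonoOn_of_injOn_Icc' hS0 hgi
  have hmI : ∀ i, D.mark i ∈ Icc (0 : ℝ) S := fun i ↦ ⟨(D.mark_mem i).1, hmS i⟩
  refine ⟨φ, fun i ↦ g (D.mark i), ⟨?_, fun i ↦ ?_⟩, fun i => rfl⟩
  · exact hgm.imp (fun h a b hab ↦ h (hmI a) (hmI b) (D.strictMono_mark hab))
      (fun h a b hab ↦ h (hmI a) (hmI b) (D.strictMono_mark hab))
  · have h1 : Tendsto φ (𝓝[upperHalfPlaneSet] (g (D.mark i) : ℂ))
        (𝓝 (Ψ₂ (cayleyFun (g (D.mark i))))) :=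
      JordanDomain.tendsto_nhdsWithin_of_extension φ hΨ₂c hΨ₂eq' (by simp)
    rw [hΨ₂g _ (hne _ (hmI i))] at h1
    exact h1

/-! ## §P6 Convergence of the modulus along uniformly convergent marked loops -/

/-- Boundary loops converging uniformly, evaluated along converging parameters, converge. [folklore] -/
theorem tendsto_boundary_of_tendstoUniformly (R : ConformalRectangle) (Q : ℕ → ConformalRectangle)
    (hbd : TendstoUniformly (fun n => (Q n).boundary) R.boundary atTop) {m : ℕ → ℝ} {m₀ : ℝ}
    (hm : Tendsto m atTop (𝓝 m₀)) :
    Tendsto (fun n => (Q n).boundary (m n)) atTop (𝓝 (R.boundary m₀)) := by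
  rw [Metric.tendsto_nhds]
  intro ε hε
  have h1 : ∀ᶠ n in atTop, ∀ t, dist (R.boundary t) ((Q n).boundary t) < ε / 2 :=
    Metric.tendstoUniformly_iff.1 hbd (ε / 2) (half_pos hε)
  have h2 : ∀ᶠ n in atTop, dist (R.boundary (m n)) (R.boundary m₀) < ε / 2 :=
    Metric.tendsto_nhds.1 ((R.continuous_boundary.tendsto m₀).comp hm) (ε / 2) (half_pos hε)
  filter_upwards [h1, h2] with n hn1 hn2
  calc dist ((Q n).boundary (m n)) (R.boundary m₀)
        ≤ dist ((Q n).boundary (m n)) (R.boundary (m n)) + dist (R.boundary (m n)) (R.boundary m₀) :=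
          dist_triangle _ _ _
    _ < ε / 2 + ε / 2 := add_lt_add (by rw [dist_comm]; exact hn1 (m n)) hn2
    _ = ε := by ring

/-- **Core of Radó-continuity of the modulus.** If `Q n → R` as marked Jordan loops (boundary
parametrisations uniformly, marks pointwise) and a point `z₀ ∈ R` lies in every `Q n`, then,
eventually, EVERY uniformizing datum of `Q n` has cross-ratio within `ε` of that of `R`.
Proof: normalised charts at `z₀` (§P2), Radó's theorem (`rado_tendstoUniformlyOn_holds`, closed
disc), convergence of the circle preimages of the marked points and of the auxiliary point
`∂(t₁)` (§P4), the explicit data of §P5 (continuous in these preimages: inverse Cayley map off `1`,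
real part, cross-ratio with non-vanishing denominators) and datum independence
(`crossRatio_eq_of_isUniformizing_holds`). [cite: PommerenkeBBCM1992, Thm. 2.11 and Cor. 2.7] -/
theorem eventually_abs_crossRatio_sub_lt (R : ConformalRectangle)
    {φR : ConformalEquiv upperHalfPlaneSet R.carrier} {x : Fin 4 → ℝ} (hux : R.IsUniformizing φR x)
    (Q : ℕ → ConformalRectangle) {z₀ : ℂ} (hz₀ : z₀ ∈ R.carrier) (hzQ : ∀ n, z₀ ∈ (Q n).carrier)
    (hbd : TendstoUniformly (fun n => (Q n).boundary) R.boundary atTop)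
    (hmk : ∀ i, Tendsto (fun n => (Q n).mark i) atTop (𝓝 (R.mark i))) {ε : ℝ} (hε : 0 < ε) :
    ∀ᶠ n in atTop, ∀ (ψ : ConformalEquiv upperHalfPlaneSet (Q n).carrier) (y : Fin 4 → ℝ),
      (Q n).IsUniformizing ψ y → |crossRatio y - crossRatio x| < ε := by
  -- normalised charts
  obtain ⟨C₀, hC₀Φ, hC₀f, hC₀re, hC₀im⟩ := exists_discChart_deriv_pos R.toJordanDomain hz₀
  choose C hCΦ hCf hCre hCim using fun n => exists_discChart_deriv_pos (Q n).toJordanDomain (hzQ n)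
  -- Radó
  have hunif : TendstoUniformlyOn (fun n => (C n).Φ) C₀.Φ atTop (closedBall (0 : ℂ) 1) :=
    JordanDomain.rado_tendstoUniformlyOn_holds.closedBall (fun n => (Q n).toJordanDomain)
      R.toJordanDomain (fun n => (C n).φ) C₀.φ (fun n => by rw [hCf n, hC₀f])
      (fun n => ⟨hCre n, hCim n⟩) ⟨hC₀re, hC₀im⟩ hbd (fun n => (C n).Φ) C₀.Φ
      (fun n => (C n).continuousOn) (fun n => (C n).eqOn) C₀.continuousOn C₀.eqOn
  -- the auxiliary parameter past the marks
  have h0 := (R.mark_mem 0).1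
  have h3 := (R.mark_mem 3).2
  set t₁ : ℝ := (R.mark 3 + 1) / 2 with ht₁
  have ht1 : t₁ < 1 := by rw [ht₁]; linarith
  have h3' : R.mark 3 < t₁ := by rw [ht₁]; linarith
  have hRt : ∀ i, R.mark i < t₁ := fun i =>
    lt_of_le_of_lt (R.strictMono_mark.monotone (Fin.le_last i) : R.mark i ≤ R.mark 3) h3'
  have ht0 : 0 ≤ t₁ := h0.trans (hRt 0).le
  have hQt : ∀ᶠ n in atTop, ∀ i, (Q n).mark i < t₁ :=
    eventually_all.2 fun i => (hmk i).eventually (gt_mem_nhds (hRt i))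
  -- convergence of the circle preimages (§P4)
  have hK : IsCompact (closedBall (0 : ℂ) 1) := isCompact_closedBall 0 1
  have hmemβ : ∀ (D : ConformalRectangle) (C' : D.DiscChart) (t : ℝ), C'.β t ∈ closedBall (0 : ℂ) 1 :=
    fun D C' t => mem_closedBall_zero_iff.2 (C'.norm_β t).le
  have hβ : ∀ {m : ℕ → ℝ} {m₀ : ℝ}, Tendsto m atTop (𝓝 m₀) →
      Tendsto (fun n => (C n).β (m n)) atTop (𝓝 (C₀.β m₀)) := by
    intro m m₀ hm
    refine tendsto_of_tendstoUniformlyOn_of_injOn hK hunif C₀.continuousOn C₀.injOn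
      (fun n => hmemβ _ (C n) (m n)) (hmemβ _ C₀ m₀) ?_
    have : (fun n => (C n).Φ ((C n).β (m n))) = fun n => (Q n).boundary (m n) := by
      funext n; exact (C n).apply_β (m n)
    rw [this, C₀.apply_β]
    exact tendsto_boundary_of_tendstoUniformly R Q hbd hm
  have hβt : Tendsto (fun n => (C n).β t₁) atTop (𝓝 (C₀.β t₁)) := hβ tendsto_const_nhds
  have hβi : ∀ i, Tendsto (fun n => (C n).β ((Q n).mark i)) atTop (𝓝 (C₀.β (R.mark i))) :=
    fun i => hβ (hmk i)
  -- the explicit data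
  set w₀ : Fin 4 → ℂ := fun i => (C₀.β t₁)⁻¹ * C₀.β (R.mark i) with hw₀
  set ws : ℕ → Fin 4 → ℂ := fun n i => ((C n).β t₁)⁻¹ * (C n).β ((Q n).mark i) with hws
  set x₀ : Fin 4 → ℝ := fun i => (cayleyInvFun (w₀ i)).re with hx₀
  set xs : ℕ → Fin 4 → ℝ := fun n i => (cayleyInvFun (ws n i)).re with hxs
  have hη0 : C₀.β t₁ ≠ 0 := norm_ne_zero_iff.1 (by rw [C₀.norm_β]; exact one_ne_zero)
  have hw : ∀ i, Tendsto (fun n => ws n i) atTop (𝓝 (w₀ i)) := fun i =>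
    (hβt.inv₀ hη0).mul (hβi i)
  have hw₀1 : ∀ i, w₀ i ≠ 1 := by
    intro i h1
    have h2 : C₀.β (R.mark i) = C₀.β t₁ := by
      have := congrArg (fun u => C₀.β t₁ * u) h1
      simp only [hw₀, ← mul_assoc, mul_inv_cancel₀ hη0, one_mul, mul_one] at this
      exact this
    have h3 : R.boundary (R.mark i) = R.boundary t₁ := by rw [← C₀.apply_β, h2, C₀.apply_β]
    have h4 : R.mark i = t₁ := R.injOn_boundary (R.mark_mem i) ⟨ht0, ht1⟩ h3
    exact absurd (hRt i) (by rw [h4]; exact lt_irrefl _)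
  have hx : ∀ i, Tendsto (fun n => xs n i) atTop (𝓝 (x₀ i)) := by
    intro i
    have hca : ContinuousAt cayleyInvFun (w₀ i) :=
      differentiableOn_cayleyInvFun.continuousOn.continuousAt (isOpen_ne.mem_nhds (hw₀1 i))
    exact (continuous_re.tendsto _).comp (hca.tendsto.comp (hw i))
  -- `x₀` is a datum of `R`, hence has distinct entries and the cross-ratio of `x`
  obtain ⟨φ₀, x₀', hux₀, hx₀'⟩ := exists_isUniformizing_of_discChart R C₀ hRt ht1
  have hxx : x₀' = x₀ := funext fun i => by rw [hx₀' i]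
  rw [hxx] at hux₀
  have hcrR : crossRatio x = crossRatio x₀ :=
    ConformalRectangle.crossRatio_eq_of_isUniformizing_holds hux hux₀
  have hinj₀ := hux₀.injective
  have h02 : x₀ 0 - x₀ 2 ≠ 0 := sub_ne_zero.2 fun h => absurd (hinj₀ h) (by decide)
  have h13 : x₀ 1 - x₀ 3 ≠ 0 := sub_ne_zero.2 fun h => absurd (hinj₀ h) (by decide)
  have hcr : Tendsto (fun n => crossRatio (xs n)) atTop (𝓝 (crossRatio x₀)) := by
    show Tendsto (fun n => (xs n 0 - xs n 1) * (xs n 2 - xs n 3) / ((xs n 0 - xs n 2) * (xs n 1 - xs n 3)))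
      atTop (𝓝 ((x₀ 0 - x₀ 1) * (x₀ 2 - x₀ 3) / ((x₀ 0 - x₀ 2) * (x₀ 1 - x₀ 3))))
    exact (((hx 0).sub (hx 1)).mul ((hx 2).sub (hx 3))).div
      (((hx 0).sub (hx 2)).mul ((hx 1).sub (hx 3))) (mul_ne_zero h02 h13)
  have hcrε : ∀ᶠ n in atTop, |crossRatio (xs n) - crossRatio x₀| < ε := by
    have := Metric.tendsto_nhds.1 hcr ε hε
    simpa only [Real.dist_eq] using this
  filter_upwards [hQt, hcrε] with n hn hnε ψ y huy
  -- datum independence on `Q n`: its modulus is `crossRatio (xs n)`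
  obtain ⟨φ', x', hux', hx'⟩ := exists_isUniformizing_of_discChart (Q n) (C n) hn ht1
  have hxx' : x' = xs n := funext fun i => by rw [hx' i]
  rw [hxx'] at hux'
  rw [ConformalRectangle.crossRatio_eq_of_isUniformizing_holds huy hux', hcrR]
  exact hnε

/-! ## §P7 The stub -/

/-- **Stub D1 (`stub_cardyContinuity`) — candidate proof.** Continuity of the Cardy value of a
conformal rectangle under uniform (same-parameter) perturbation of its marked boundary loop, for
EVERY uniformizing datum of the perturbed rectangle: by contradiction, a sequence of
counterexamples `Q_n → R` with closeness `< dist(z₀, ∂R)/2` swallows a fixed `z₀ ∈ R` (§P1), so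
§P6 applies, and `F` is continuous on `[0, 1]` (`continuousOn_cardyFunction_holds`).
[cite: PommerenkeBBCM1992, Thm. 2.11 and Cor. 2.4] -/
theorem stub_cardyContinuity_proof :
    ∀ (R : ConformalRectangle) (φ : ConformalEquiv UpperHalfPlane.upperHalfPlaneSet R.carrier)
      (x : Fin 4 → ℝ), R.IsUniformizing φ x → ∀ τ : ℝ, 0 < τ → ∃ ε₀ : ℝ, 0 < ε₀ ∧
      ∀ (Q : ConformalRectangle), (∀ u : ℝ, dist (Q.boundary u) (R.boundary u) ≤ ε₀) →
        (∀ i : Fin 4, |Q.mark i - R.mark i| ≤ ε₀) →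
        ∀ (ψ : ConformalEquiv UpperHalfPlane.upperHalfPlaneSet Q.carrier) (y : Fin 4 → ℝ),
          Q.IsUniformizing ψ y →
          |Literature.Probability.RandomPlanarGeometry.cardyFunction (crossRatio y) -
            Literature.Probability.RandomPlanarGeometry.cardyFunction (crossRatio x)| ≤ τ := by
  intro R φ x hux τ hτ
  -- continuity of `F` at `η = crossRatio x` within `[0, 1]`
  have hη : crossRatio x ∈ Ioo (0 : ℝ) 1 := crossRatio_mem_Ioo hux.1
  obtain ⟨ε, hε, hF⟩ := Metric.continuousWithinAt_iff.1
    (continuousOn_cardyFunction_holds (crossRatio x) (Ioo_subset_Icc_self hη)) τ hτ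
  by_contra hcon
  push Not at hcon
  -- a deep point of `R` and a sequence of counterexamples swallowing it
  obtain ⟨z₀, hz₀⟩ := R.nonempty
  have hzf : z₀ ∉ frontier R.carrier := fun h' => Set.disjoint_left.1 R.disjoint_carrier_frontier hz₀ h'
  have hd₀ : 0 < infDist z₀ (frontier R.carrier) :=
    (R.isCompact_frontier.isClosed.notMem_iff_infDist_pos ⟨_, R.boundary_mem_frontier 0⟩).1 hzf
  set d : ℝ := infDist z₀ (frontier R.carrier) with hd
  set δ : ℕ → ℝ := fun n => d / 2 / ((n : ℝ) + 1) with hδ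
  have hδpos : ∀ n, 0 < δ n := fun n => by rw [hδ]; positivity
  have hδlt : ∀ n, δ n < d := fun n => by
    rw [hδ]
    have hn1 : (1 : ℝ) ≤ (n : ℝ) + 1 := by
      have : (0 : ℝ) ≤ n := n.cast_nonneg
      linarith
    calc d / 2 / ((n : ℝ) + 1) ≤ d / 2 := div_le_self (by positivity) hn1
      _ < d := by linarith
  have hδto : Tendsto δ atTop (𝓝 0) := by
    have h1 : Tendsto (fun n : ℕ => ((n : ℝ) + 1)⁻¹) atTop (𝓝 0) := by
      have := tendsto_one_div_add_atTop_nhds_zero_nat (𝕜 := ℝ)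
      simpa only [one_div] using this
    have h2 : Tendsto (fun n : ℕ => d / 2 * ((n : ℝ) + 1)⁻¹) atTop (𝓝 (d / 2 * 0)) :=
      h1.const_mul (d / 2)
    rw [mul_zero] at h2
    refine h2.congr fun n => ?_
    rw [hδ]; simp only; rw [div_eq_mul_inv (d / 2)]
  choose Q hQb hQm ψ y hQu hbad using fun n => hcon (δ n) (hδpos n)
  have hzQ : ∀ n, z₀ ∈ (Q n).carrier := fun n =>
    mem_carrier_of_forall_dist_boundary_lt R.toJordanDomain (Q n).toJordanDomain hz₀
      fun t => (hQb n t).trans_lt (hδlt n)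
  have hbd : TendstoUniformly (fun n => (Q n).boundary) R.boundary atTop := by
    rw [Metric.tendstoUniformly_iff]
    intro e he
    filter_upwards [(tendsto_order.1 hδto).2 e he] with n hn t
    rw [dist_comm]
    exact (hQb n t).trans_lt hn
  have hmk : ∀ i, Tendsto (fun n => (Q n).mark i) atTop (𝓝 (R.mark i)) := by
    intro i
    rw [Metric.tendsto_nhds]
    intro e he
    filter_upwards [(tendsto_order.1 hδto).2 e he] with n hn
    rw [Real.dist_eq]
    exact (hQm n i).trans_lt hn
  have hev := eventually_abs_crossRatio_sub_lt R hux Q hz₀ hzQ hbd hmk hε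
  obtain ⟨n, hn⟩ := hev.exists
  have h1 : |crossRatio (y n) - crossRatio x| < ε := hn (ψ n) (y n) (hQu n)
  have h2 := hF (Ioo_subset_Icc_self (crossRatio_mem_Ioo (hQu n).1)) (by rwa [Real.dist_eq])
  rw [Real.dist_eq] at h2
  exact absurd (hbad n) (not_lt.2 h2.le)

end Summit.CriticalPhenomena.CardyFormulaZ2.Cruxes.LoopsToCrossings.DrefuteD1

end
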